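import Literature.AlgebraicTopology.SingularHomology.SimplyConnectedH1
import Literature.AlgebraicTopology.SingularHomology.UniversalCoefficients
import HarnessLib

/-!
# The Kronecker map `H¹(X; R) → Hom_R(H₁(X; R), R)` is an isomorphism (universal coefficients, degree one)

A. Hatcher, *Algebraic Topology*, CUP 2002, §3.1, Thm. 3.2 (p. 195) with pp. 198–199: the
Kronecker map `h : Hⁿ(X; G) → Hom(Hₙ(X), G)` is onto with kernel `Ext(Hₙ₋₁(X), G)`. In degree
`n = 1` the kernel is `Ext(H₀(X), G) = 0`, **because `H₀(X)` is free** (on the path components,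
Prop. 2.7); so `h : H¹(X; G) → Hom(H₁(X), G)` is an isomorphism for *every* space `X` (Hatcher,
§3.1, p. 198: "`H¹(X; G) ≈ Hom(H₁(X), G)`").  The tree vendors Thm. 3.2 as the two named facts
`Literature.AlgebraicTopology.SingularHomology.kroneckerMap_surjective` and `Literature.AlgebraicTopology.SingularHomology.ker_kroneckerMap_le_torsion` (`UniversalCoefficients.lean`).
This file PROVES the degree-one case (injectivity and surjectivity) for the tree's singular
(co)homology (`Literature.singularCohomology R R X 1`, `Literature.kroneckerPairing R R X 1`, `CapProduct.lean`)
over any commutative ring `R`, by the direct cochain arguments: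

* `Literature.AlgebraicTopology.SingularHomology.KroneckerDegreeOne.exists_basePaths`: a base point `β p` in each path component
  (`β p = β q` when `p`, `q` are joined) and paths `ω_p : β p ⇝ p` to every point.
* `Literature.AlgebraicTopology.SingularHomology.KroneckerDegreeOne.apply_ofPath_add_sub` (**key**): if the class of a `1`-cocycle `φ`
  pairs to zero with `H₁(X; R)`, then `φ(γ) + φ(ω_a) - φ(ω_b) = 0` for every path `γ : a ⇝ b` —
  the chain `γ + ω_a - ω_b` is a cycle (evaluation formula `kroneckerPairing_π_single`).
* `Literature.AlgebraicTopology.SingularHomology.kroneckerPairing_one_eq_zero`: such a class vanishes: with the `0`-cochain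
  `ψ[p] := φ(ω_p)` one has `δψ(γ) = ψ(b) - ψ(a) = φ(γ)` for every singular `1`-simplex
  `γ : a ⇝ b` (every singular `1`-simplex is the simplex of a path, `SimplyConnectedH1.lean`),
  so `φ = δψ` is a coboundary.
* `Literature.AlgebraicTopology.SingularHomology.ker_kroneckerPairing_one_eq_bot`, `Literature.AlgebraicTopology.SingularHomology.kroneckerPairing_one_injective`: `ker h = 0`.
* `Literature.AlgebraicTopology.SingularHomology.ker_kroneckerMap_le_torsion_zero_holds`: the instance `n = 0` of the named fact
  `ker_kroneckerMap_le_torsion R X 0` (**discharged**, for every `X`).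
* `Literature.AlgebraicTopology.SingularHomology.isZero_singularCohomology_one_of_isZero`, `…_of_simplyConnectedSpace`:
  `H₁(X; R) = 0 ⇒ H¹(X; R) = 0`; in particular `H¹(X; R) = 0` for simply connected `X`
  (with `isZero_singularHomology_one_of_simplyConnectedSpace`).
* `Literature.AlgebraicTopology.SingularHomology.KroneckerDegreeOne.exists_cycleMap`, `Literature.AlgebraicTopology.SingularHomology.kroneckerPairing_one_surjective` (**onto**): for
  `f : H₁(X; R) → R` the cochain `φ(σ) := f [T σ]`, `T = 𝟙 - Φ∂` (`Φ[p] = ω_p`), is a cocycle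
  with `⟨[φ], -⟩ = f`; `Literature.AlgebraicTopology.SingularHomology.kroneckerPairing_one_bijective`; `Literature.AlgebraicTopology.SingularHomology.kroneckerMap_surjective_one_holds`:
  the instance `n = 1` of the named fact `kroneckerMap_surjective` (**discharged**, every `X`).

Client: the homotopy-4-sphere criterion `spc4.S10` (`HomotopyS4Criterion.lean`): for a closed
simply connected 4-manifold, `H¹ = 0` and Poincaré duality `H¹ ≅ H₃` give `H₃ = 0` without the
finiteness / torsion facts (Thm. 3.2 in higher degrees, Cor. 3.28). No declaration in this file
uses `sorry`.

## References

* A. Hatcher, *Algebraic Topology*, CUP 2002, §3.1: Thm. 3.2 (p. 195), pp. 198–199, and §2.1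
  Prop. 2.7 (`H₀` is free on the path components) [HatcherAT2002].
-/

noncomputable section

open CategoryTheory Limits

universe u v

namespace Literature.AlgebraicTopology.SingularHomology

variable (R : Type v) [CommRing R]
variable {X : Type u} [TopologicalSpace X]

open SingularSimplex singularChainComplex singularCochainComplex

namespace KroneckerDegreeOne

variable {R}

/-- `(-m) • σ = -(m • σ)` for elementary chains. [folklore] -/
lemma single_neg {M : Type v} [AddCommGroup M] [Module R M] {n : ℕ} (σ : SingularSimplex X n)
    (m : M) : single (R := R) σ (-m) = -single (R := R) σ m := by
  rw [← singleₗ_apply, map_neg, singleₗ_apply]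

omit R in
variable (X) in
/-- **Base points and base paths.** There are a choice of a point `β p` in the path component of
each `p ∈ X`, depending only on the path component (`β p = β q` when `p`, `q` are joined), and
paths `ω_p : β p ⇝ p`. [folklore] -/
lemma exists_basePaths :
    ∃ (β : X → X) (_ : ∀ p : X, Path (β p) p), ∀ p q : X, Joined p q → β p = β q := by
  let β : X → X := fun p => @Classical.epsilon X ⟨p⟩ fun q => q ∈ pathComponent p
  have hβ : ∀ p, Joined (β p) p := fun p => by
    have h : β p ∈ pathComponent p :=
      Classical.epsilon_spec (p := fun q => q ∈ pathComponent p) ⟨p, mem_pathComponent_self p⟩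
    exact (mem_pathComponent_iff.1 h).symm
  refine ⟨β, fun p => (hβ p).somePath, fun p q hpq => ?_⟩
  have he : pathComponent q = pathComponent p := pathComponent_congr hpq
  change @Classical.epsilon X ⟨p⟩ (fun r => r ∈ pathComponent p) =
    @Classical.epsilon X ⟨q⟩ (fun r => r ∈ pathComponent q)
  simp only [he]

/-- **Key step.** Let `ω_p : β p ⇝ p` be paths from base points. If the class of a singular
`1`-cocycle `φ` pairs to zero with every class of `H₁(X; R)` under the Kronecker pairing, then
`φ(γ) + φ(ω_a) - φ(ω_b) = 0` for every path `γ : a ⇝ b` with `β a = β b`: the `1`-chain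
`γ + ω_a - ω_b` is a cycle, and `⟨[φ], [γ + ω_a - ω_b]⟩ = φ(γ) + φ(ω_a) - φ(ω_b)`
(Hatcher 2002, §3.1, p. 191, evaluation of a cocycle on a cycle). [cite: HatcherAT2002, §3.1 Thm. 3.2] -/
lemma apply_ofPath_add_sub (φ : cocycles R R X 1)
    (h : kroneckerPairing R R X 1 (singularCohomology.π R R X 1 φ) = 0) {β : X → X}
    (ω : ∀ p : X, Path (β p) p) {a b : X} (hab : β a = β b) (γ : Path a b) :
    iCocycles R R X 1 φ (ofPath γ) + iCocycles R R X 1 φ (ofPath (ω a)) -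
      iCocycles R R X 1 φ (ofPath (ω b)) = 0 := by
  set K := singularChainComplex R R X
  let σ : Fin 3 → SingularSimplex X 1 := ![ofPath γ, ofPath (ω a), ofPath (ω b)]
  let m : Fin 3 → R := ![1, 1, -1]
  set z : K.X 1 := ∑ i, single (R := R) (σ i) (m i) with hzdef
  have hz3 : z = single (R := R) (ofPath γ) 1 + single (R := R) (ofPath (ω a)) 1 +
      single (R := R) (ofPath (ω b)) (-1) := by
    rw [hzdef, Fin.sum_univ_three]
    rfl
  have hz : K.d 1 0 z = 0 := by
    rw [hz3, map_add, map_add, d_single_ofPath, d_single_ofPath, d_single_ofPath, hab,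
      single_neg, single_neg]
    abel
  let zc : cycles R R X 1 := K.cyclesMk z 0 (by simp) hz
  have hzc : iCycles R R X 1 zc = ∑ i ∈ Finset.univ, single (R := R) (σ i) (m i) :=
    K.i_cyclesMk z 0 (by simp) hz
  have h0 : kroneckerPairing R R X 1 (singularCohomology.π R R X 1 φ) (K.homologyπ 1 zc) = 0 := by
    rw [h, LinearMap.zero_apply]
  rw [kroneckerPairing_π_single Finset.univ σ m φ zc hzc, Fin.sum_univ_three] at h0
  change iCocycles R R X 1 φ (ofPath γ) • (1 : R) + iCocycles R R X 1 φ (ofPath (ω a)) • (1 : R)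
    + iCocycles R R X 1 φ (ofPath (ω b)) • (-1 : R) = 0 at h0
  rw [smul_eq_mul, smul_eq_mul, smul_eq_mul, mul_one, mul_one, mul_neg_one, ← sub_eq_add_neg] at h0
  exact h0

end KroneckerDegreeOne

open KroneckerDegreeOne

/-! ### Injectivity of the Kronecker map in degree one -/

/-- **A class of `H¹(X; R)` that pairs to zero with `H₁(X; R)` is zero** (Hatcher 2002, §3.1,
Thm. 3.2 in degree one: `ker h = Ext(H₀(X), G) = 0` since `H₀(X)` is free, pp. 195–199).
Proof: represent the class by a cocycle `φ`; the `0`-cochain `ψ[p] := φ(ω_p)` (`ω_p` the chosen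
path from the base point of the path component of `p`) satisfies `δψ = φ`, because for a singular
`1`-simplex `γ : a ⇝ b` (every `1`-simplex is the simplex of a path) `δψ(γ) = ψ(b) - ψ(a)
= φ(ω_b) - φ(ω_a) = φ(γ)` by `apply_ofPath_add_sub`. [cite: HatcherAT2002, §3.1 Thm. 3.2] -/
theorem kroneckerPairing_one_eq_zero (a : singularCohomology R R X 1)
    (h : kroneckerPairing R R X 1 a = 0) : a = 0 := by
  induction a using singularCohomology_induction_on with
  | h φ =>
    obtain ⟨β, ω, hβ⟩ := exists_basePaths X
    -- the `0`-cochain `ψ[p] = φ(ω_p)`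
    let ψ : (singularCochainComplex R R X).X 0 :=
      fun ρ : SingularSimplex X 0 => iCocycles R R X 1 φ (ofPath (ω ρ.pt))
    have hψ : (singularCochainComplex R R X).d 0 1 ψ = iCocycles R R X 1 φ := by
      refine singularCochainComplex.ext fun τ => ?_
      obtain ⟨a, b, γ, rfl⟩ := τ.exists_eq_ofPath
      rw [singularCochainComplex.d_apply, Fin.sum_univ_two, ofPath_face_zero, ofPath_face_one]
      simp only [Fin.val_zero, pow_zero, one_smul, Fin.val_one, pow_one, neg_smul]
      change iCocycles R R X 1 φ (ofPath (ω (ofPoint b).pt)) +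
        -iCocycles R R X 1 φ (ofPath (ω (ofPoint a).pt)) = iCocycles R R X 1 φ (ofPath γ)
      rw [pt_ofPoint, pt_ofPoint]
      have hk := apply_ofPath_add_sub φ h ω (hβ a b ⟨γ⟩) γ
      linear_combination -hk
    have hφ : φ = toCocycles R R X 0 1 ψ :=
      cocycles_ext (by rw [iCocycles_toCocycles, hψ])
    rw [hφ, π_toCocycles]

/-- **The Kronecker map `H¹(X; R) → Hom_R(H₁(X; R), R)` has trivial kernel**, for every space
`X` and commutative ring `R` (Hatcher 2002, §3.1, Thm. 3.2 in degree one, `Ext(H₀(X), G) = 0`).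
[cite: HatcherAT2002, §3.1 Thm. 3.2] -/
theorem ker_kroneckerPairing_one_eq_bot :
    LinearMap.ker (kroneckerPairing R R X 1) = ⊥ :=
  LinearMap.ker_eq_bot'.2 fun a ha => kroneckerPairing_one_eq_zero R a ha

/-- **The Kronecker map `H¹(X; R) → Hom_R(H₁(X; R), R)` is injective** (Hatcher 2002, §3.1,
Thm. 3.2 in degree one; p. 198). [cite: HatcherAT2002, §3.1 Thm. 3.2] -/
theorem kroneckerPairing_one_injective : Function.Injective (kroneckerPairing R R X 1) :=
  LinearMap.ker_eq_bot.1 (ker_kroneckerPairing_one_eq_bot R)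

/-- **Discharge of the named fact `ker_kroneckerMap_le_torsion R X 0`** (the degree-one instance
of Hatcher 2002, Thm. 3.2 as vendored in `UniversalCoefficients.lean`): the kernel of
`h : H¹(X; R) → Hom_R(H₁(X; R), R)` is even trivial, for every space `X` (no finiteness needed).
[cite: HatcherAT2002, §3.1 Thm. 3.2] -/
theorem ker_kroneckerMap_le_torsion_zero_holds [IsDomain R] [IsPrincipalIdealRing R]
    (X : Type u) [TopologicalSpace X] : ker_kroneckerMap_le_torsion R X 0 := by
  intro _
  change LinearMap.ker (kroneckerPairing R R X 1) ≤ _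
  rw [ker_kroneckerPairing_one_eq_bot]
  exact bot_le

/-! ### `H₁ = 0 ⇒ H¹ = 0` -/

/-- **`H₁(X; R) = 0` implies `H¹(X; R) = 0`** (Hatcher 2002, §3.1, p. 198:
`H¹(X; G) ≈ Hom(H₁(X), G)`; here from the injectivity of the Kronecker map).
[cite: HatcherAT2002, §3.1 Thm. 3.2] -/
theorem isZero_singularCohomology_one_of_isZero (h : IsZero (singularHomology R R X 1)) :
    IsZero (singularCohomology R R X 1) := by
  haveI := ModuleCat.subsingleton_of_isZero h
  haveI : Subsingleton (singularCohomology R R X 1) := subsingleton_of_forall_eq 0 fun a =>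
    kroneckerPairing_one_eq_zero R a (LinearMap.ext fun c => by
      rw [Subsingleton.elim c 0, map_zero, LinearMap.zero_apply])
  exact ModuleCat.isZero_of_subsingleton _

/-- **`H¹(X; R) = 0` for a simply connected space** (Hatcher 2002, Thm. 2A.1 and §3.1 p. 198:
`H₁ = 0`, `H¹ ≈ Hom(H₁, R) = 0`). [cite: HatcherAT2002, §3.1 Thm. 3.2] -/
theorem isZero_singularCohomology_one_of_simplyConnectedSpace [SimplyConnectedSpace X] :
    IsZero (singularCohomology R R X 1) :=
  isZero_singularCohomology_one_of_isZero R (isZero_singularHomology_one_of_simplyConnectedSpace R R)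

/-! ### Surjectivity of the Kronecker map in degree one -/

namespace KroneckerDegreeOne

variable {R}

/-- **The chain map `T = 𝟙 - Φ ∘ ∂ : C₁ → C₁`** attached to base paths `ω_p : β p ⇝ p`, where
`Φ : C₀ → C₁` is `m[p] ↦ m ω_p`: it sends `m γ` (`γ : a ⇝ b`) to `m γ + m ω_a - m ω_b` and fixes
cycles. Stated as an existence statement (the construction passes through the comparison with
concrete chains in degree `0`, as in `SimplyConnectedH1.lean`). [folklore] -/
lemma exists_cycleMap {β : X → X} (ω : ∀ p : X, Path (β p) p) :
    ∃ T : (singularChainComplex R R X).X 1 →ₗ[R] (singularChainComplex R R X).X 1,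
      (∀ {a b : X} (γ : Path a b) (m : R), T (single (R := R) (ofPath γ) m) =
        single (R := R) (ofPath γ) m + single (R := R) (ofPath (ω a)) m -
          single (R := R) (ofPath (ω b)) m) ∧
      ∀ c, (singularChainComplex R R X).d 1 0 c = 0 → T c = c := by
  set K := singularChainComplex R R X
  let Φ₀ : CChain R X 0 →ₗ[R] K.X 1 :=
    Finsupp.lsum R fun ρ : SingularSimplex X 0 =>
      (singleₗ (R := R) (ofPath (ω ρ.pt)) : R →ₗ[R] K.X 1)
  let Φ : K.X 0 →ₗ[R] K.X 1 := Φ₀ ∘ₗ (csingularChainComplex.compInv R R X 0).hom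
  have hΦ : ∀ (p : X) (m : R),
      Φ (single (R := R) (ofPoint p) m) = single (R := R) (ofPath (ω p)) m := by
    intro p m
    change Φ₀ ((csingularChainComplex.compInv R R X 0).hom (single (R := R) (ofPoint p) m)) = _
    rw [csingularChainComplex.compInv_single]
    change Finsupp.lsum R _ (Finsupp.single (ofPoint p) m) = _
    rw [Finsupp.lsum_single]
    change single (R := R) (ofPath (ω (ofPoint p).pt)) m = _
    rw [SingularSimplex.pt_ofPoint]
  refine ⟨LinearMap.id - Φ ∘ₗ (K.d 1 0).hom, fun γ m => ?_, fun c hc => ?_⟩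
  · rw [LinearMap.sub_apply, LinearMap.id_apply, LinearMap.comp_apply]
    change _ - Φ (K.d 1 0 _) = _
    rw [d_single_ofPath, map_sub, hΦ, hΦ]
    abel
  · rw [LinearMap.sub_apply, LinearMap.id_apply, LinearMap.comp_apply]
    change c - Φ (K.d 1 0 c) = c
    rw [hc, map_zero, sub_zero]

/-- **Surjectivity of `h : H¹(X; R) → Hom_R(H₁(X; R), R)`** (Hatcher 2002, §3.1, Thm. 3.2 in
degree one; p. 198: "`H¹(X; G) ≈ Hom(H₁(X), G)`"). Given `f : H₁(X; R) → R`, with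
`T = 𝟙 - Φ∂` as above (linear, `∂ ∘ T = 0`, `T = 𝟙` on cycles) put `φ(σ) := f [T σ]`; then
`δφ(τ) = f [T ∂τ] = f [∂τ] = 0`, and `⟨[φ], [z]⟩ = f [T z] = f [z]` for every cycle `z`
(the two linear maps `c ↦ ⟨[φ], [T c]⟩` and `c ↦ f [T c]` agree on elementary chains because
`φ(ω_a) = φ(ω_b) = f [ω_{β a}]` for `a`, `b` in one path component).
[cite: HatcherAT2002, §3.1 Thm. 3.2] -/
theorem _root_.Literature.AlgebraicTopology.SingularHomology.kroneckerPairing_one_surjective :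
    Function.Surjective (kroneckerPairing R R X 1) := by
  intro f
  set K := singularChainComplex R R X
  obtain ⟨β, ω, hβ⟩ := exists_basePaths X
  obtain ⟨T, hT, hTz⟩ := exists_cycleMap (R := R) ω
  -- `∂ ∘ T = 0`
  have hdT : ModuleCat.ofHom T ≫ K.d 1 0 = 0 := by
    refine singularChainComplex.hom_ext fun σ m => ?_
    obtain ⟨a, b, γ, rfl⟩ := σ.exists_eq_ofPath
    change K.d 1 0 (T (single (R := R) (ofPath γ) m)) = 0
    rw [hT, map_sub, map_add, d_single_ofPath, d_single_ofPath, d_single_ofPath, hβ a b ⟨γ⟩]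
    abel
  -- `T` with values in cycles, and the functional `L = f ∘ π ∘ T`
  let T' : K.X 1 ⟶ cycles R R X 1 := K.liftCycles (ModuleCat.ofHom T) 0 (by simp) hdT
  have hT'i : ∀ c, iCycles R R X 1 (T' c) = T c := fun c => by
    change (T' ≫ K.iCycles 1) c = T c
    rw [K.liftCycles_i]
    rfl
  have hT'd : ∀ w : K.X 2, T' (K.d 2 1 w) = toCycles R R X 2 1 w := fun w =>
    cycles_ext (by
      rw [hT'i, iCycles_toCycles]
      refine hTz _ ?_
      change (K.d 2 1 ≫ K.d 1 0) w = 0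
      rw [K.d_comp_d]
      rfl)
  let L : K.X 1 →ₗ[R] R := f ∘ₗ (T' ≫ K.homologyπ 1).hom
  have hL : ∀ c, L c = f (K.homologyπ 1 (T' c)) := fun c => rfl
  have hLd : ∀ w : K.X 2, L (K.d 2 1 w) = 0 := fun w => by
    rw [hL, hT'd, homologyπ_toCycles, map_zero]
  -- the cochain `φ(σ) = L(σ)` is a cocycle
  let φ : (singularCochainComplex R R X).X 1 := fun σ => L (single (R := R) σ 1)
  have hLsingle : ∀ (σ : SingularSimplex X 1) (m : R), L (single (R := R) σ m) = φ σ * m := by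
    intro σ m
    have e : single (R := R) σ m = m • single (R := R) σ 1 := by
      rw [← singularChainComplex.single_smul, smul_eq_mul, mul_one]
    rw [e, map_smul, smul_eq_mul, mul_comm]
  have hφ : (singularCochainComplex R R X).d 1 2 φ = 0 := by
    refine singularCochainComplex.ext fun τ => ?_
    have h := hLd (single (R := R) τ 1)
    rw [d_single_two, map_add, map_sub] at h
    rw [singularCochainComplex.d_apply, Fin.sum_univ_three]
    simp only [Fin.val_zero, pow_zero, one_smul, Fin.val_one, pow_one, neg_smul, Fin.val_two,
      neg_one_sq]
    change L (single (R := R) (τ.face 0) 1) + -L (single (R := R) (τ.face 1) 1) +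
      L (single (R := R) (τ.face 2) 1) = 0
    linear_combination h
  let φc : cocycles R R X 1 := cocyclesMk φ hφ
  have hic : iCocycles R R X 1 φc = φ := iCocycles_mk φ hφ
  -- `φ(ω_a) = φ(ω_b)` when `β a = β b`
  have hωT : ∀ {a b : X}, β a = β b →
      T' (single (R := R) (ofPath (ω a)) 1) = T' (single (R := R) (ofPath (ω b)) 1) := by
    intro a b hab
    refine cycles_ext ?_
    rw [hT'i, hT'i, hT, hT, add_sub_cancel_left, add_sub_cancel_left, hab]
  have hφω : ∀ {a b : X}, β a = β b → φ (ofPath (ω a)) = φ (ofPath (ω b)) := by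
    intro a b hab
    change L _ = L _
    rw [hL, hL, hωT hab]
  -- the two functionals `c ↦ ⟨[φ], [T c]⟩` and `L` agree
  let A : K.X 1 →ₗ[R] R := (kroneckerPairing R R X 1 (singularCohomology.π R R X 1 φc)) ∘ₗ
    (T' ≫ K.homologyπ 1).hom
  have hsingle : ∀ (σ : SingularSimplex X 1) (m : R),
      A (single (R := R) σ m) = L (single (R := R) σ m) := by
    intro σ m
    obtain ⟨a, b, γ, rfl⟩ := σ.exists_eq_ofPath
    let s : Fin 3 → SingularSimplex X 1 := ![ofPath γ, ofPath (ω a), ofPath (ω b)]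
    let cf : Fin 3 → R := ![m, m, -m]
    have hTs : iCycles R R X 1 (T' (single (R := R) (ofPath γ) m)) =
        ∑ i ∈ Finset.univ, single (R := R) (s i) (cf i) := by
      rw [hT'i, hT, Fin.sum_univ_three]
      change _ = single (R := R) (ofPath γ) m + single (R := R) (ofPath (ω a)) m +
        single (R := R) (ofPath (ω b)) (-m)
      rw [single_neg, ← sub_eq_add_neg]
    have hA : A (single (R := R) (ofPath γ) m) =
        ∑ i ∈ Finset.univ, iCocycles R R X 1 φc (s i) • cf i :=
      kroneckerPairing_π_single Finset.univ s cf φc _ hTs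
    rw [hA, Fin.sum_univ_three, hic]
    change φ (ofPath γ) • m + φ (ofPath (ω a)) • m + φ (ofPath (ω b)) • (-m) =
      L (single (R := R) (ofPath γ) m)
    rw [hLsingle, hφω (hβ a b ⟨γ⟩), smul_eq_mul, smul_eq_mul, smul_eq_mul]
    ring
  have hAL : ∀ c : K.X 1, A c = L c := by
    intro c
    have hc : c = csingularChainComplex.compHom R R X 1 (csingularChainComplex.compInv R R X 1 c) := by
      change c = (csingularChainComplex.compInv R R X 1 ≫ csingularChainComplex.compHom R R X 1) c
      rw [csingularChainComplex.compInv_compHom]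
      rfl
    rw [hc]
    generalize (csingularChainComplex.compInv R R X 1) c = w
    induction w using Finsupp.induction_linear with
    | zero => rw [map_zero, map_zero, map_zero]
    | add x y hx hy => rw [map_add, map_add, map_add, hx, hy]
    | single σ m =>
      have e := csingularChainComplex.compHom_single (R := R) (M := R) (X := X) σ m
      change A ((csingularChainComplex.compHom R R X 1).hom (Finsupp.single σ m)) =
        L ((csingularChainComplex.compHom R R X 1).hom (Finsupp.single σ m))
      rw [e]
      exact hsingle σ m
  -- conclusion
  refine ⟨singularCohomology.π R R X 1 φc, LinearMap.ext fun c => ?_⟩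
  induction c using singularHomology_induction_on with
  | h zc =>
    have hz : T' (iCycles R R X 1 zc) = zc :=
      cycles_ext (by rw [hT'i, hTz _ (d_iCycles 0 zc)])
    have lhs : kroneckerPairing R R X 1 (singularCohomology.π R R X 1 φc) (K.homologyπ 1 zc) =
        A (iCycles R R X 1 zc) := by
      change _ = kroneckerPairing R R X 1 (singularCohomology.π R R X 1 φc)
        (K.homologyπ 1 (T' (iCycles R R X 1 zc)))
      rw [hz]
    rw [lhs, hAL, hL, hz]

end KroneckerDegreeOne

/-- **The Kronecker map `H¹(X; R) → Hom_R(H₁(X; R), R)` is bijective**, for every space `X` and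
commutative ring `R` (Hatcher 2002, §3.1, Thm. 3.2 in degree one; p. 198:
"`H¹(X; G) ≈ Hom(H₁(X), G)`"). [cite: HatcherAT2002, §3.1 Thm. 3.2] -/
theorem kroneckerPairing_one_bijective : Function.Bijective (kroneckerPairing R R X 1) :=
  ⟨kroneckerPairing_one_injective R, kroneckerPairing_one_surjective⟩

/-- **Discharge of the named fact `kroneckerMap_surjective R X 1`** (the degree-one instance of
Hatcher 2002, Thm. 3.2 as vendored in `UniversalCoefficients.lean`): `h : H¹(X; R) → Hom_R(H₁(X; R), R)`
is onto, for every space `X`. [cite: HatcherAT2002, §3.1 Thm. 3.2] -/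
theorem kroneckerMap_surjective_one_holds [IsDomain R] [IsPrincipalIdealRing R]
    (X : Type u) [TopologicalSpace X] : kroneckerMap_surjective R X 1 :=
  kroneckerPairing_one_surjective

end Literature.AlgebraicTopology.SingularHomology

end
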